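import Summits.Ventures.HSemireg.ObstructionLocusLocalLemma

/-!
# Venture HSemireg — (S5) OBSTRUCTION LOCUS away from secant type, X: the LOCAL LEMMA L1 of the SR design in the
# kernel, brick 4 — the matrix identity behind L1 (ii) «`Ext¹_R(I_W, I_W) → Ext¹_R(I_W, R)` is ZERO»

HONEST FRAMING.  Companion of `ObstructionLocusLocalLemma.lean` (cell `pub-hsemireg`, track «S4-PUSH» (ii), seat
s4-prove-2): plain commutative algebra in `R = MvPolynomial (Fin n) K`, every `n`, `K` any commutative domain
(e.g. `k[y]`).  Nothing here constructs a variety or a sheaf; nothing here says that HC / HC_CM / HC_AV holds; no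
Literature fact is declared or used; Mathlib's derived `Ext` is NOT used — what is proved is the MATRIX IDENTITY to
which the printed proof of L1 (ii) (general-structure/eng1/g2/G2-REDUCIBLE-POINT-THEOREM.md §2) reduces the
statement, and the reduction itself
(«by (pd), `Ext¹(I,N) = N^{n−1}/{(x_1ν_1 − x_kν_k)_k : ν ∈ Nⁿ}` functorially in `N`; the map in question is `[w] ↦ [w]`
for `w ∈ I^{n−1} ⊂ R^{n−1}`, so it is zero iff `I·R^{n−1} ⊂ im(Rⁿ → R^{n−1})`») stays DICTIONARY.

* `relMap k₀ : Rⁿ → R^{{k ≠ k₀}}`, `ν ↦ (x_{k₀} ν_{k₀} − x_k ν_k)_k` — the transpose of the Hilbert–Burch matrix of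
  file VIII (`sum_mul_cofactor_eq_zero_iff`: the syzygies of `(m_k)` are the `(x_k s_k)` with `Σ s_k = 0`, i.e. the
  span of the columns `x_{k₀} e_{k₀} − x_k e_k`).
* `single_cofactor_mem_range_relMap` — the two explicit preimages of the printed proof: `m_l e_k = relMap(−m_{kl} e_k)`
  for `l ≠ k`, and `m_k e_k = relMap(ν)` with `ν_i = m_{ik}` (`i ≠ k`), `ν_k = 0`.
* **`mem_range_relMap_of_forall_mem`** — **L1 (ii), matrix form: every vector with entries in `I_W` is in the image of
  `relMap`** (`I_W · R^{{k ≠ k₀}} ⊆ im relMap`), every `n ≥ 1`, every base index `k₀`.  Under the dictionary above this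
  is «`Ext¹_R(I_W, I_W) → Ext¹_R(I_W, R)` is zero», whence (long exact sequence of `0 → I → R → R/I → 0`, and
  `Hom_R(I, R) → Hom_R(I, R/I)` zero) «`δ : Hom_R(I_W, R/I_W) ⥲ Ext¹_R(I_W, I_W)`: every first-order deformation of the
  module `I_W` is the ideal of an embedded first-order deformation of `W`» — the second input of (H-arr) for literal
  ideal sheaves (EXT-NOTE §6.B(b)).  The les / Ext identification is NOT formalised here.
* `prod_X_dvd_of_forall_dvd`, `X_mul_apply_gen_eq`, **`exists_eq_mul_of_hom_to_ring`** — `Hom_R(I_W, R) = R·ι`: every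
  `R`-linear `I_W → R` is multiplication by a polynomial; **`mkQ_comp_hom_to_ring_eq_zero`** — hence
  `Hom_R(I_W, R) → Hom_R(I_W, R/I_W)` is zero (the printed reason for the INJECTIVITY of `δ`).
* `finitePresentation_srDesignIdeal`, **`isLocalizedModule_normalModule`** — L1 LOCALISES (Remark (a) loc. cit.): the
  normal module computed in files VIII/IX base-changes to every localisation `R_S` (Mathlib's
  `Module.FinitePresentation.isLocalizedModule_map`; `K` Noetherian); completion not covered.
References (dictionary only): G2-REDUCIBLE-POINT-THEOREM.md §2 L1 (ii); EXT-NOTE.md §6.B(b).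
-/

open scoped BigOperators
open MvPolynomial Finset

namespace Summit.Ventures.HSemireg.ObstructionLocus

variable {K : Type*} [CommRing K] {n : ℕ}

/-- `m_{jk} = ∏_{l ∉ {j,k}} x_l` again (as in file IX; restated here to keep this leaf independent of IX). -/
noncomputable def cofactorPair (j k : Fin n) : MvPolynomial (Fin n) K := ∏ l ∈ (univ.erase k).erase j, X l

/-- `x_j · m_{jk} = m_k` (`j ≠ k`). -/
theorem X_mul_cofactorPair {j k : Fin n} (hjk : j ≠ k) :
    X j * cofactorPair j k = (cofactor k : MvPolynomial (Fin n) K) := by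
  rw [cofactorPair, cofactor, Finset.mul_prod_erase (univ.erase k) (fun l => (X l : MvPolynomial (Fin n) K))
    (mem_erase.2 ⟨hjk, mem_univ j⟩)]

/-- The transposed Hilbert–Burch map `relMap k₀ : Rⁿ → R^{{k ≠ k₀}}`, `ν ↦ (x_{k₀} ν_{k₀} − x_k ν_k)_{k ≠ k₀}`
(`Hom(F_0, N) → Hom(F_1, N)` of the resolution of file VIII, at `N = R`). -/
noncomputable def relMap (k₀ : Fin n) :
    (Fin n → MvPolynomial (Fin n) K) →ₗ[MvPolynomial (Fin n) K] ({k : Fin n // k ≠ k₀} → MvPolynomial (Fin n) K) where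
  toFun ν k := X k₀ * ν k₀ - X k.1 * ν k.1
  map_add' ν μ := by
    funext k
    simp only [Pi.add_apply]
    ring
  map_smul' c ν := by
    funext k
    simp only [Pi.smul_apply, smul_eq_mul, RingHom.id_apply]
    ring

/-- Components of `relMap`. -/
theorem relMap_apply (k₀ : Fin n) (ν : Fin n → MvPolynomial (Fin n) K) (k : {k : Fin n // k ≠ k₀}) :
    relMap k₀ ν k = X k₀ * ν k₀ - X k.1 * ν k.1 := rfl

/-- **The two explicit preimages of the printed proof**: `m_l · e_k ∈ im relMap` for every `l` and every `k ≠ k₀`. -/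
theorem single_cofactor_mem_range_relMap (k₀ : Fin n) (k : {k : Fin n // k ≠ k₀}) (l : Fin n) :
    Pi.single k (cofactor l : MvPolynomial (Fin n) K) ∈ LinearMap.range (relMap (K := K) k₀) := by
  classical
  by_cases hlk : l = k.1
  · -- `l = k`: `ν_i = m_{ik}` for `i ≠ k`, `ν_k = 0`
    subst hlk
    refine ⟨fun i => if i = k.1 then 0 else cofactorPair i k.1, ?_⟩
    funext k'
    rw [relMap_apply, if_neg k.2.symm, X_mul_cofactorPair k.2.symm]
    by_cases hk' : k' = k
    · subst hk'
      rw [if_pos rfl, mul_zero, sub_zero, Pi.single_eq_same]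
    · have hne : k'.1 ≠ k.1 := fun h => hk' (Subtype.ext h)
      rw [if_neg hne, X_mul_cofactorPair hne, sub_self, Pi.single_eq_of_ne hk']
  · -- `l ≠ k`: `ν = −m_{kl} e_k`
    refine ⟨Pi.single k.1 (-cofactorPair k.1 l), ?_⟩
    funext k'
    rw [relMap_apply, Pi.single_eq_of_ne k.2.symm, mul_zero, zero_sub]
    by_cases hk' : k' = k
    · subst hk'
      rw [Pi.single_eq_same, Pi.single_eq_same, mul_neg, neg_neg, X_mul_cofactorPair (Ne.symm hlk)]
    · have hne : k'.1 ≠ k.1 := fun h => hk' (Subtype.ext h)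
      rw [Pi.single_eq_of_ne hne, Pi.single_eq_of_ne hk', mul_zero, neg_zero]

/-- **L1 (ii), matrix form (every `n`, every domain `K`, every base index `k₀`).**  Every vector with entries in `I_W` lies
in the image of the transposed Hilbert–Burch map: `I_W · R^{{k ≠ k₀}} ⊆ im relMap`.  (Dictionary: with `Ext¹` computed
by the resolution of file VIII this says that `Ext¹_R(I_W, I_W) → Ext¹_R(I_W, R)` is the zero map.) -/
theorem mem_range_relMap_of_forall_mem (k₀ : Fin n) (w : {k : Fin n // k ≠ k₀} → MvPolynomial (Fin n) K)
    (hw : ∀ k, w k ∈ srDesignIdeal K n) : w ∈ LinearMap.range (relMap (K := K) k₀) := by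
  classical
  have hdec : w = ∑ k, Pi.single k (w k) := (Finset.univ_sum_single w).symm
  rw [hdec]
  refine Submodule.sum_mem _ fun k _ => ?_
  -- `w k ∈ I_W = span (m_l)`: induct over the span
  refine Submodule.span_induction (p := fun f _ => Pi.single k f ∈ LinearMap.range (relMap (K := K) k₀))
    ?_ ?_ ?_ ?_ (hw k)
  · rintro _ ⟨l, rfl⟩
    exact single_cofactor_mem_range_relMap k₀ k l
  · rw [Pi.single_zero]; exact Submodule.zero_mem _
  · intro f g _ _ hf hg
    rw [Pi.single_add]; exact Submodule.add_mem _ hf hg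
  · intro r f _ hf
    have : Pi.single (M := fun _ : {k : Fin n // k ≠ k₀} => MvPolynomial (Fin n) K) k (r • f)
        = r • Pi.single (M := fun _ : {k : Fin n // k ≠ k₀} => MvPolynomial (Fin n) K) k f := by
      funext k'
      by_cases hk' : k' = k
      · subst hk'; simp
      · simp [hk']
    rw [this]
    exact Submodule.smul_mem _ r hf

/-- The same for the whole submodule: `I_W · R^{{k ≠ k₀}} ≤ im relMap`. -/
theorem pi_srDesignIdeal_le_range_relMap (k₀ : Fin n) :
    Submodule.pi Set.univ (fun _ : {k : Fin n // k ≠ k₀} => (srDesignIdeal K n : Submodule (MvPolynomial (Fin n) K) _))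
      ≤ LinearMap.range (relMap (K := K) k₀) :=
  fun w hw => mem_range_relMap_of_forall_mem k₀ w fun k => hw k (Set.mem_univ k)

/-! ## `Hom_R(I_W, R) = R · (inclusion)`, hence `Hom_R(I_W, R) → Hom_R(I_W, R/I_W)` is zero (L1 (ii), injectivity) -/

/-- Distinct coordinate functions are «coprime» in the UFD sense: if every `x_k`, `k ∈ S`, divides `c`, so does
`∏_{k ∈ S} x_k`. -/
theorem prod_X_dvd_of_forall_dvd [IsDomain K] (S : Finset (Fin n)) {c : MvPolynomial (Fin n) K}
    (h : ∀ k ∈ S, (X k : MvPolynomial (Fin n) K) ∣ c) : (∏ k ∈ S, (X k : MvPolynomial (Fin n) K)) ∣ c := by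
  classical
  induction S using Finset.induction_on generalizing c with
  | empty => simp
  | insert k S hkS ih =>
    rw [Finset.prod_insert hkS]
    obtain ⟨d, rfl⟩ := ih fun l hl => h l (Finset.mem_insert_of_mem hl)
    have hk := h k (Finset.mem_insert_self k S)
    rcases (X_prime (R := K) (σ := Fin n) (i := k)).dvd_or_dvd hk with h1 | h1
    · exfalso
      rw [(X_prime (R := K) (σ := Fin n) (i := k)).dvd_finsetProd_iff] at h1
      obtain ⟨l, hl, hkl⟩ := h1
      rw [X_dvd_X] at hkl
      exact hkS (hkl ▸ hl)
    · obtain ⟨e, rfl⟩ := h1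
      exact ⟨e, by ring⟩

/-- For any `R`-linear `φ : I_W → R`: `x_j φ(m_j) = x_k φ(m_k)` (cancel `m_{jk}` in
`m_k φ(m_j) = φ(m_j m_k) = m_j φ(m_k)`). -/
theorem X_mul_apply_gen_eq [IsDomain K]
    (φ : srDesignIdeal K n →ₗ[MvPolynomial (Fin n) K] MvPolynomial (Fin n) K) (j k : Fin n) :
    X j * φ ⟨cofactor j, cofactor_mem j⟩ = X k * φ ⟨cofactor k, cofactor_mem k⟩ := by
  by_cases hjk : j = k
  · rw [hjk]
  have h1 : cofactor k * φ ⟨cofactor j, cofactor_mem j⟩ = cofactor j * φ ⟨cofactor k, cofactor_mem k⟩ := by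
    rw [← smul_eq_mul, ← smul_eq_mul, ← map_smul, ← map_smul]
    congr 1
    apply Subtype.ext
    change cofactor k * cofactor j = cofactor j * cofactor k
    ring
  set a := φ ⟨cofactor j, cofactor_mem j⟩ with ha
  set b := φ ⟨cofactor k, cofactor_mem k⟩ with hb
  have e1 : (cofactor k : MvPolynomial (Fin n) K) = X j * cofactorPair j k := (X_mul_cofactorPair hjk).symm
  have e2 : (cofactor j : MvPolynomial (Fin n) K) = X k * cofactorPair k j :=
    (X_mul_cofactorPair (Ne.symm hjk)).symm
  have hcomm : (cofactorPair k j : MvPolynomial (Fin n) K) = cofactorPair j k := by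
    rw [cofactorPair, cofactorPair, Finset.erase_right_comm]
  have hne : (cofactorPair j k : MvPolynomial (Fin n) K) ≠ 0 :=
    Finset.prod_ne_zero_iff.2 fun l _ => X_ne_zero l
  have h2 : cofactorPair j k * (X j * a) = cofactorPair j k * (X k * b) := by
    calc cofactorPair j k * (X j * a) = cofactor k * a := by rw [e1]; ring
      _ = cofactor j * b := h1
      _ = cofactorPair j k * (X k * b) := by rw [e2, hcomm]; ring
  exact mul_left_cancel₀ hne h2

/-- **`Hom_R(I_W, R) = R · ι`**: every `R`-linear map `I_W → R` is multiplication by a polynomial (the common value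
`x_k φ(m_k)` is divisible by every `x_k`, hence by `x_1 ⋯ x_n`).  Every `n`, every domain `K`. -/
theorem exists_eq_mul_of_hom_to_ring [IsDomain K]
    (φ : srDesignIdeal K n →ₗ[MvPolynomial (Fin n) K] MvPolynomial (Fin n) K) :
    ∃ a : MvPolynomial (Fin n) K, ∀ f : srDesignIdeal K n, φ f = a * f.1 := by
  rcases Nat.eq_zero_or_pos n with hn | hn
  · -- `n = 0`: no generators, `I_W = 0`
    subst hn
    refine ⟨0, fun f => ?_⟩
    have hf : (f : MvPolynomial (Fin 0) K) = 0 := by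
      have h2 := f.2
      have hr : Set.range (cofactor (K := K) (n := 0)) = ∅ := Set.range_eq_empty _
      change (f : MvPolynomial (Fin 0) K) ∈ Ideal.span (Set.range (cofactor (K := K) (n := 0))) at h2
      rw [hr, Ideal.span_empty, Ideal.mem_bot] at h2
      exact h2
    have hf0 : f = 0 := Subtype.ext hf
    rw [hf0, map_zero, zero_mul]
  · set k₀ : Fin n := ⟨0, hn⟩ with hk₀
    set c := X k₀ * φ ⟨cofactor k₀, cofactor_mem k₀⟩ with hc
    have hdvd : (∏ k, (X k : MvPolynomial (Fin n) K)) ∣ c :=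
      prod_X_dvd_of_forall_dvd univ fun k _ => ⟨φ ⟨cofactor k, cofactor_mem k⟩, by
        rw [hc, X_mul_apply_gen_eq φ k₀ k]⟩
    obtain ⟨a, ha⟩ := hdvd
    refine ⟨a, ?_⟩
    -- on generators
    have hgen : ∀ k, φ ⟨cofactor k, cofactor_mem k⟩ = a * cofactor k := by
      intro k
      have h1 : X k * φ ⟨cofactor k, cofactor_mem k⟩ = X k * (a * cofactor k) := by
        rw [← X_mul_apply_gen_eq φ k₀ k, ← hc, ha, ← X_mul_cofactor k]
        ring
      exact (X_mul_cancel_left_iff (i := k)).1 h1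
    -- on all of `I_W`
    intro f
    obtain ⟨r, rfl⟩ := genMap_surjective f
    rw [genMap_apply_coe, Finset.mul_sum]
    simp only [genMap, LinearMap.sum_apply, LinearMap.smulRight_apply, LinearMap.proj_apply, map_sum,
      map_smul, hgen, smul_eq_mul]
    exact Finset.sum_congr rfl fun k _ => by ring

/-- **`Hom_R(I_W, R) → Hom_R(I_W, R/I_W)` is the ZERO map** (L1 (ii): with the long exact sequence of
`0 → I → R → R/I → 0` this is the injectivity of `δ : Hom(I, R/I) → Ext¹(I, I)`; the les is dictionary). -/
theorem mkQ_comp_hom_to_ring_eq_zero [IsDomain K]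
    (φ : srDesignIdeal K n →ₗ[MvPolynomial (Fin n) K] MvPolynomial (Fin n) K) :
    (Submodule.mkQ (srDesignIdeal K n)).comp φ = 0 := by
  obtain ⟨a, ha⟩ := exists_eq_mul_of_hom_to_ring φ
  apply LinearMap.ext
  intro f
  rw [LinearMap.comp_apply, Submodule.mkQ_apply, ha, LinearMap.zero_apply, Submodule.Quotient.mk_eq_zero]
  exact Ideal.mul_mem_left _ a f.2

/-! ## Localisation (L1 Remark (a)): the computed normal module localises -/

/-- `I_W` is a finitely presented `R`-module (`R = K[x_1, …, x_n]` is Noetherian for Noetherian `K`; file VIII's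
`genMap` / `sum_mul_cofactor_eq_zero_iff` is an explicit presentation). -/
instance finitePresentation_srDesignIdeal [IsNoetherianRing K] :
    Module.FinitePresentation (MvPolynomial (Fin n) K) (srDesignIdeal K n) :=
  Module.finitePresentation_of_finite _ _

/-- **L1 localises (Remark (a) of the source), by Mathlib's general base change of `Hom` out of a finitely presented
module**: for every multiplicative set `S ⊆ R` and all localisation maps `f : I_W → (I_W)_S`, `g : R/I_W → (R/I_W)_S`,
the induced map `Hom_R(I_W, R/I_W) → Hom_R((I_W)_S, (R/I_W)_S)` IS a localisation at `S`
(`Module.FinitePresentation.isLocalizedModule_map`).  Hence `Hom_{R_S}((I_W)_S, (R/I_W)_S) = (⊕_k ⊕_{j≠k} R/(x_j,x_k))_S`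
— in particular at every prime / every point of `W` (and, with `K = k[y]`, of `W × 𝔸^m`); completion is NOT covered. -/
theorem isLocalizedModule_normalModule [IsNoetherianRing K] (S : Submonoid (MvPolynomial (Fin n) K))
    {IS : Type*} [AddCommGroup IS] [Module (MvPolynomial (Fin n) K) IS]
    (f : srDesignIdeal K n →ₗ[MvPolynomial (Fin n) K] IS) [IsLocalizedModule S f]
    {QS : Type*} [AddCommGroup QS] [Module (MvPolynomial (Fin n) K) QS]
    (g : (MvPolynomial (Fin n) K ⧸ srDesignIdeal K n) →ₗ[MvPolynomial (Fin n) K] QS) [IsLocalizedModule S g] :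
    IsLocalizedModule S (IsLocalizedModule.map S f g) :=
  inferInstance

end Summit.Ventures.HSemireg.ObstructionLocus
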